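import Summits.ValiantsHypothesis.ValiantsHypothesis.Theorems.BarrierLeverPartitionMinorsHitByVPHiddenStatesLowerNode

/-!
# Route BarrierLever — item `PartitionMinorsHitByVP` (stmt-ValiantsHypothesis-19717), line `hidden_states`:
# the MAJORITY node — «more than half of a fixed list of designs is good for each lower family» ⇒ the PAIR node ⇒ the crux

Helper file (`--supports stmt-ValiantsHypothesis-19717`; cell valiant-natproofs, rung V4, 𝒟-side door (c); prover seat val-np-p6 gen 9).
One typed statement (`LowerNode.Stmt.majorityJoinWideLower`, a CONJECTURE, not asserted) and its kernel-checked compositions. Closes NO item.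

WHY (memo HOME/val-np-p6/g9/MEMO-valnp6-g9.md §5, census kit/rd_census.py): for RANDOM legal wide designs (comparable random weights, m ∈ {h, 2h}
pieces, K ∈ {h, h+2, 2h} states) EVERY sampled design was good for EVERY tested lower family (h = 6–10). Goodness looks generic over designs, which
suggests proving the crux not through ONE universal design (`Stmt.universalJoinWideLower`) but through a LIST of designs most of which are good for
each family: by pigeonhole two lower families of the same size then share a good design, which is exactly the PAIR node
(`Stmt.pairJoinWideLower`, p599518) and hence the crux (b = 12).

* `Stmt.majorityJoinWideLower` — for all large `h` and every `r ≤ 2^h` there is a nonempty list of legal wide join threshold families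
  (`m ≤ 2h`, `K ≤ h³`) of size `r` such that for every injective lower `u` of size `r`, MORE THAN HALF of the list is good for `u`.
* `pairJoinWideLower_of_majority`, `partitionMinorsHitByVP_of_majority` — the compositions; `majority_of_universalJoinWideLower` — a universal
  design is a list of length one.

WHAT THIS IS NOT: the majority statement is OPEN (censused, not proved); item 19717 OPEN; nothing on crux 14610 or VP ≠ VNP.
-/

set_option linter.dupNamespace false

namespace Summit.ValiantsHypothesis.ValiantsHypothesis.Theorems.BarrierLever.HiddenStates

open Finset Matrix MvPolynomial

noncomputable section

namespace LowerNode

/-- A legal wide join threshold design of size `r` at height `h`, bundled: pieces `m ≤ 2h`, states `K ≤ h³`, offsets, weights, an injective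
column enumeration with the joint strict threshold property. (A `structure` only to keep the majority statement readable.) -/
structure WideDesign (h r : ℕ) where
  /-- number of pieces -/
  m : ℕ
  /-- number of states -/
  K : ℕ
  /-- piece offsets -/
  W : Fin m → ℕ
  /-- state weights -/
  wt : Fin m → Fin K → ℕ
  /-- the columns -/
  e : Fin r → Fin m × Finset (Fin K)
  hm : m ≤ h + h
  hK : K ≤ h * h * h
  he : Function.Injective e
  hthr : ∀ x : Fin m × Finset (Fin K), x ∉ Set.range e →
    ∀ i, W (e i).1 + ∑ k ∈ (e i).2, wt (e i).1 k < W x.1 + ∑ k ∈ x.2, wt x.1 k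

/-- The design `D` is good for the row family `u`: some table makes the block-additive matrix nonsingular. -/
def WideDesign.Good {h r : ℕ} (D : WideDesign h r) (u : Fin r → Finset (Fin h)) : Prop :=
  ∃ tx : Fin D.m → Option (Fin D.K) → Fin h → ℂ,
    (Matrix.of fun i k : Fin r =>
      ∏ a ∈ u i, (tx (D.e k).1 none a + ∑ q ∈ (D.e k).2, tx (D.e k).1 (some q) a)).det ≠ 0

/-- **The MAJORITY node restricted to lower sets (typed; not asserted).** For all large `h` and every `r ≤ 2^h` there is a nonempty finite list
of legal wide designs such that every injective lower row family of size `r` is good for MORE THAN HALF of the list (stated with an explicit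
set `S` of good indices, `2|S| > M`). -/
def Stmt.majorityJoinWideLower : Prop :=
  ∃ h₁ : ℕ, ∀ h : ℕ, h₁ ≤ h → ∀ r : ℕ, r ≤ 2 ^ h →
    ∃ (M : ℕ) (D : Fin M → WideDesign h r), 0 < M ∧
      ∀ u : Fin r → Finset (Fin h), Function.Injective u → IsLowerSet (Set.range u) →
        ∃ S : Finset (Fin M), (∀ i ∈ S, (D i).Good u) ∧ M < 2 * S.card

/-- Two subsets of `Fin M`, each of more than half the size, intersect. -/
theorem exists_mem_inter_of_majorities {M : ℕ} (A B : Finset (Fin M)) (hA : M < 2 * A.card) (hB : M < 2 * B.card) :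
    ∃ i, i ∈ A ∧ i ∈ B := by
  by_contra hno
  push Not at hno
  have hdisj : Disjoint A B := Finset.disjoint_left.mpr fun i hiA hiB => hno i hiA hiB
  have hcard : (A ∪ B).card ≤ M := by
    simpa using Finset.card_le_univ (A ∪ B)
  rw [Finset.card_union_of_disjoint hdisj] at hcard
  omega

/-- **Majority ⇒ pair.** Two lower families of the same size share a good design of the list (pigeonhole). -/
theorem pairJoinWideLower_of_majority (H : Stmt.majorityJoinWideLower) : Stmt.pairJoinWideLower := by
  classical
  obtain ⟨h₁, H⟩ := H
  refine ⟨h₁, fun h hh r u w hu hw hlu hlw => ?_⟩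
  have hr : r ≤ 2 ^ h := by
    have := Fintype.card_le_of_injective u hu
    rwa [Fintype.card_fin, Fintype.card_finset, Fintype.card_fin] at this
  obtain ⟨M, D, _, hmaj⟩ := H h hh r hr
  obtain ⟨Su, hSu, hcu⟩ := hmaj u hu hlu
  obtain ⟨Sw, hSw, hcw⟩ := hmaj w hw hlw
  obtain ⟨i, hiu, hiw⟩ := exists_mem_inter_of_majorities Su Sw hcu hcw
  exact ⟨(D i).m, (D i).K, (D i).W, (D i).wt, (D i).e, (D i).hm, (D i).hK, (D i).he, (D i).hthr, hSu i hiu, hSw i hiw⟩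

/-- **The crux from the majority node** (`b = 12`). -/
theorem partitionMinorsHitByVP_of_majority (H : Stmt.majorityJoinWideLower) :
    Summit.ValiantsHypothesis.ValiantsHypothesis.Theses.BarrierLever.PartitionMinorsHitByVP :=
  partitionMinorsHitByVP_of_pairJoinWideLower (pairJoinWideLower_of_majority H)

/-- A universal design is a majority list of length one. -/
theorem majority_of_universalJoinWideLower (H : Stmt.universalJoinWideLower) : Stmt.majorityJoinWideLower := by
  classical
  obtain ⟨h₁, H⟩ := H
  refine ⟨h₁, fun h hh r hr => ?_⟩
  obtain ⟨m, K, W, wt, e, hm, hK, he, hthr, Hu⟩ := H h hh r hr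
  refine ⟨1, fun _ => ⟨m, K, W, wt, e, hm, hK, he, hthr⟩, Nat.one_pos, fun u hu hlu => ⟨Finset.univ, fun i _ => Hu u hu hlu, ?_⟩⟩
  rw [Finset.card_univ, Fintype.card_fin]
  norm_num

end LowerNode

end

end Summit.ValiantsHypothesis.ValiantsHypothesis.Theorems.BarrierLever.HiddenStates
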